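import Mathlib
import HarnessLib
import Summits.Ventures.LatticeQCDFlow.Scoring.GaussianShiftedBallThreshold
import Summits.Ventures.LatticeQCDFlow.Scoring.AgreementTestLocalPower

/-!
# TWO CRITERIA ON THE SAME PAIR OF RUNS: FOR A CENTRED GAUSSIAN PAIR WITH ANY CORRELATION,
# `P(|X| ≤ a ∧ |Y| ≤ b) ≥ P(|X| ≤ a)·P(|Y| ≤ b)` (ŠIDÁK'S INEQUALITY FOR TWO SYMMETRIC WINDOWS),
# FROM CHEBYSHEV'S ASSOCIATION INEQUALITY

HONEST FRAMING: exact (Metropolis-corrected) sampling algorithms for lattice gauge theory;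
figures of merit are autocorrelation/cost numbers at stated couplings and volumes; no
continuum-physics claim.

Venture `LatticeQCDFlow` (cell pub-lqcd), topic `Scoring`; FANOUT row 4 (`s0-u1-b`, GEN-35).
NEW WORK of the cell (classical; our formalisation), no definition, nothing cited as a fact
(Chebyshev's "other" inequality / association of comonotone functions and Šidák (1967) NAMED ONLY).

WHY (row 4).  The card's acceptance sentence has TWO criteria per coupling ("acceptance A vs B
within 3 pp" AND "τ_int(Q) A vs B within 1σ_comb"), computed from the SAME pair of runs, hence
DEPENDENT.  `Scoring/SimultaneousAgreementIndependentColumns` multiplies levels across independent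
couplings and lists dependence between the columns of ONE coupling as NOT CLAIMED.  In the Gaussian
limit the two studentised differences of one coupling form a centred Gaussian pair with some
correlation; this file proves that for such a pair the probability that BOTH symmetric-window
criteria pass is AT LEAST the product of the two single-criterion levels, whatever the correlation —
so the product (Šidák) calibration of the two criteria is conservative, and Bonferroni more so.
Representation: `X = Z₁`, `Y = ρ Z₁ + τ Z₂` with `Z₁, Z₂` independent standard normal, `τ > 0`
(every non-degenerate centred Gaussian pair is of this form up to positive scalings of `X` and `Y`,
which symmetric windows absorb).  Proof: conditionally on `Z₁ = t` the second criterion has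
probability `g(t) = N(ρt/τ, 1)([−b/τ, b/τ])`, an even function non-increasing in `|t|`
(`Scoring/GaussianShiftedBallMonotone`); so is `1_{[−a,a]}`; two functions of `t` that decrease
together are positively associated under any law of `t` (**`integral_mul_ge_of_comonotone`**,
Chebyshev: `∬ (f(x)−f(y))(g(x)−g(y)) ≥ 0`), which is the claim after Fubini
(**`gaussianPair_abs_le_inter_ge_mul`**).

§3 adds the analytic core for ANY number of criteria loading on ONE common factor
(**`prod_integral_le_integral_prod_of_antitone_score`**: `∏_j ∫ g_j ≤ ∫ ∏_j g_j` for `[0,1]`-valued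
functions all non-increasing in a common score — Chebyshev iterated).

NOT CLAIMED: the chain-level bivariate CLT hook-up of the two printed criteria (their joint limit is
`Scoring/MarkovChainBivariateCLT`'s business); general covariances with three or more criteria
(Šidák's general theorem / the Gaussian correlation inequality); numbers.
-/

open MeasureTheory ProbabilityTheory Filter Topology

namespace Summit.Ventures.LatticeQCDFlow.Scoring

open Set

/-! ## §1 Chebyshev's association inequality -/

section Chebyshev

variable {α : Type*} [MeasurableSpace α] {μ : Measure α} [IsProbabilityMeasure μ]

/-- **CHEBYSHEV'S ASSOCIATION INEQUALITY.**  If `f, g : α → ℝ` are bounded, measurable and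
COMONOTONE — `(f x − f y)(g x − g y) ≥ 0` for all `x, y` — then under any probability law
`(∫ f)(∫ g) ≤ ∫ f·g`. [folklore; ours] -/
theorem integral_mul_ge_of_comonotone {f g : α → ℝ} (hfm : Measurable f) (hgm : Measurable g)
    {Cf Cg : ℝ} (hf : ∀ x, |f x| ≤ Cf) (hg : ∀ x, |g x| ≤ Cg)
    (hco : ∀ x y, 0 ≤ (f x - f y) * (g x - g y)) :
    (∫ x, f x ∂μ) * (∫ x, g x ∂μ) ≤ ∫ x, f x * g x ∂μ := by
  -- integrability of everything in sight
  have hfi : Integrable f μ := (memLp_top_of_bound hfm.aestronglyMeasurable Cf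
    (Eventually.of_forall fun x => by rw [Real.norm_eq_abs]; exact hf x)).integrable le_top
  have hgi : Integrable g μ := (memLp_top_of_bound hgm.aestronglyMeasurable Cg
    (Eventually.of_forall fun x => by rw [Real.norm_eq_abs]; exact hg x)).integrable le_top
  have hfgb : ∀ x, |f x * g x| ≤ Cf * Cg := fun x => by
    rw [abs_mul]
    exact mul_le_mul (hf x) (hg x) (abs_nonneg _) ((abs_nonneg _).trans (hf x))
  have hfgi : Integrable (fun x => f x * g x) μ :=
    (memLp_top_of_bound (hfm.mul hgm).aestronglyMeasurable (Cf * Cg)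
      (Eventually.of_forall fun x => by rw [Real.norm_eq_abs]; exact hfgb x)).integrable le_top
  -- the double integral of `(f x − f y)(g x − g y) ≥ 0`
  set F : α × α → ℝ := fun p => (f p.1 - f p.2) * (g p.1 - g p.2) with hF
  have hFnn : 0 ≤ ∫ p, F p ∂(μ.prod μ) := integral_nonneg fun p => hco p.1 p.2
  -- expand: `F p = f·g(p.1)·1 + 1·f·g(p.2) − f(p.1) g(p.2) − g(p.1) f(p.2)`
  have hexp : ∀ p : α × α, F p = (f p.1 * g p.1) * 1 + 1 * (f p.2 * g p.2)
      - f p.1 * g p.2 - g p.1 * f p.2 := fun p => by simp only [hF]; ring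
  have h1 : ∫ p, (f p.1 * g p.1) * (1 : ℝ) ∂(μ.prod μ) = ∫ x, f x * g x ∂μ := by
    rw [integral_prod_mul (f := fun x => f x * g x) (g := fun _ => (1 : ℝ))]
    simp
  have h2 : ∫ p, (1 : ℝ) * (f p.2 * g p.2) ∂(μ.prod μ) = ∫ x, f x * g x ∂μ := by
    rw [integral_prod_mul (f := fun _ => (1 : ℝ)) (g := fun x => f x * g x)]
    simp
  have h3 : ∫ p, f p.1 * g p.2 ∂(μ.prod μ) = (∫ x, f x ∂μ) * (∫ x, g x ∂μ) :=
    integral_prod_mul (f := f) (g := g)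
  have h4 : ∫ p, g p.1 * f p.2 ∂(μ.prod μ) = (∫ x, g x ∂μ) * (∫ x, f x ∂μ) :=
    integral_prod_mul (f := g) (g := f)
  -- integrability of the four pieces on the product
  have hone : Integrable (fun _ : α => (1 : ℝ)) μ := integrable_const 1
  have i1 : Integrable (fun p : α × α => (f p.1 * g p.1) * (1 : ℝ)) (μ.prod μ) := hfgi.mul_prod hone
  have i2 : Integrable (fun p : α × α => (1 : ℝ) * (f p.2 * g p.2)) (μ.prod μ) := hone.mul_prod hfgi
  have i3 : Integrable (fun p : α × α => f p.1 * g p.2) (μ.prod μ) := hfi.mul_prod hgi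
  have i4 : Integrable (fun p : α × α => g p.1 * f p.2) (μ.prod μ) := hgi.mul_prod hfi
  have hint : ∫ p, F p ∂(μ.prod μ)
      = 2 * ∫ x, f x * g x ∂μ - 2 * ((∫ x, f x ∂μ) * (∫ x, g x ∂μ)) := by
    have e : (fun p : α × α => F p) = fun p => ((f p.1 * g p.1) * (1 : ℝ) + (1 : ℝ) * (f p.2 * g p.2)
        - f p.1 * g p.2) - g p.1 * f p.2 := by
      funext p; rw [hexp]
    have i12 : Integrable (fun p : α × α => (f p.1 * g p.1) * (1 : ℝ) + (1 : ℝ) * (f p.2 * g p.2))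
        (μ.prod μ) := i1.add i2
    have i123 : Integrable (fun p : α × α => (f p.1 * g p.1) * (1 : ℝ) + (1 : ℝ) * (f p.2 * g p.2)
        - f p.1 * g p.2) (μ.prod μ) := i12.sub i3
    rw [e, integral_sub i123 i4, integral_sub i12 i3, integral_add i1 i2, h1, h2, h3, h4]
    ring
  rw [hint] at hFnn
  linarith

end Chebyshev

/-! ## §2 The Gaussian pair `(Z₁, ρZ₁ + τZ₂)` and two symmetric windows -/

section GaussianPair

/-- Product measures as integrals of LEFT sections, real-valued: `(μ ⊗ ν)(s) = ∫ x, ν(s_x) dμ`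
(the right-section twin is `Literature.MeasureTheory.TotalVariation.measureReal_prod_eq_integral`). [folklore] -/
theorem measureReal_prod_eq_integral_left {α β : Type*} [MeasurableSpace α] [MeasurableSpace β]
    (μ : Measure α) (ν : Measure β) [SFinite ν] [IsFiniteMeasure ν] {s : Set (α × β)}
    (hs : MeasurableSet s) :
    (μ.prod ν).real s = ∫ x, ν.real (Prod.mk x ⁻¹' s) ∂μ := by
  rw [measureReal_def, Measure.prod_apply hs]
  simp only [measureReal_def]
  rw [integral_toReal (measurable_measure_prodMk_left hs).aemeasurable
    (Eventually.of_forall fun x => measure_lt_top _ _)]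

/-- The section of the second criterion: `N(0,1){w | |ρt + τw| ≤ b} = N(ρt/τ, 1)([−b/τ, b/τ])`
(`τ > 0`). [ours] -/
theorem gaussianReal_real_absLinear_le {ρ τ : ℝ} (hτ : 0 < τ) (b t : ℝ) :
    (gaussianReal 0 1).real {w : ℝ | |ρ * t + τ * w| ≤ b}
      = (gaussianReal (ρ * t / τ) 1).real (Icc (-(b / τ)) (b / τ)) := by
  rw [CardConsistency.gaussianReal_real_Icc_shift]
  congr 1
  ext w
  simp only [Set.mem_setOf_eq, Set.mem_Icc, abs_le]
  constructor
  · rintro ⟨h1, h2⟩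
    constructor
    · rw [show -(b / τ) - ρ * t / τ = (-b - ρ * t) / τ by ring, div_le_iff₀ hτ]; linarith
    · rw [show b / τ - ρ * t / τ = (b - ρ * t) / τ by ring, le_div_iff₀ hτ]; linarith
  · rintro ⟨h1, h2⟩
    rw [show -(b / τ) - ρ * t / τ = (-b - ρ * t) / τ by ring, div_le_iff₀ hτ] at h1
    rw [show b / τ - ρ * t / τ = (b - ρ * t) / τ by ring, le_div_iff₀ hτ] at h2
    constructor <;> linarith

/-- That section, as a function of `t`, is even and non-increasing in `|t|`:
`|x| ≤ |y| ⇒ g(y) ≤ g(x)` (`b ≥ 0`). [ours] -/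
theorem gaussianReal_real_absLinear_le_anti {ρ τ : ℝ} (hτ : 0 < τ) {b : ℝ} (hb : 0 ≤ b) {x y : ℝ}
    (hxy : |x| ≤ |y|) :
    (gaussianReal 0 1).real {w : ℝ | |ρ * y + τ * w| ≤ b}
      ≤ (gaussianReal 0 1).real {w : ℝ | |ρ * x + τ * w| ≤ b} := by
  rw [gaussianReal_real_absLinear_le hτ, gaussianReal_real_absLinear_le hτ]
  have hz : 0 ≤ b / τ := div_nonneg hb hτ.le
  -- reduce both centres to their absolute values (evenness), then monotonicity
  have key : ∀ u : ℝ, (gaussianReal (ρ * u / τ) 1).real (Icc (-(b / τ)) (b / τ))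
      = (gaussianReal (|ρ * u / τ|) 1).real (Icc (-(b / τ)) (b / τ)) := by
    intro u
    rcases le_or_gt 0 (ρ * u / τ) with h | h
    · rw [abs_of_nonneg h]
    · rw [abs_of_neg h, gaussianReal_real_Icc_symm_neg]
  rw [key x, key y]
  have hmono := antitoneOn_gaussianReal_real_Icc_symm hz
  refine hmono (Set.mem_Ici.2 (abs_nonneg _)) (Set.mem_Ici.2 (abs_nonneg _)) ?_
  rw [abs_div, abs_div, abs_mul, abs_mul, abs_of_pos hτ]
  exact div_le_div_of_nonneg_right (mul_le_mul_of_nonneg_left hxy (abs_nonneg ρ)) hτ.le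

/-- **ŠIDÁK'S INEQUALITY FOR TWO SYMMETRIC WINDOWS.**  For the centred Gaussian pair
`(X, Y) = (Z₁, ρZ₁ + τZ₂)` (`Z₁, Z₂` independent standard normal, any `ρ`, `τ > 0`), every `a` and
`b ≥ 0`: `P(|X| ≤ a)·P(|Y| ≤ b) ≤ P(|X| ≤ a ∧ |Y| ≤ b)`. [ours] -/
theorem gaussianPair_abs_le_inter_ge_mul (ρ : ℝ) {τ : ℝ} (hτ : 0 < τ) (a : ℝ) {b : ℝ}
    (hb : 0 ≤ b) :
    (gaussianReal 0 1).real (Icc (-a) a)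
        * ((gaussianReal 0 1).prod (gaussianReal 0 1)).real {p : ℝ × ℝ | |ρ * p.1 + τ * p.2| ≤ b}
      ≤ ((gaussianReal 0 1).prod (gaussianReal 0 1)).real
        {p : ℝ × ℝ | |p.1| ≤ a ∧ |ρ * p.1 + τ * p.2| ≤ b} := by
  set γ := gaussianReal 0 1 with hγ
  set f : ℝ → ℝ := (Icc (-a) a).indicator (1 : ℝ → ℝ) with hf
  set g : ℝ → ℝ := fun t => γ.real {w : ℝ | |ρ * t + τ * w| ≤ b} with hg
  -- measurability of the two events
  have hlin : Measurable fun p : ℝ × ℝ => |ρ * p.1 + τ * p.2| := by fun_prop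
  have hB : MeasurableSet {p : ℝ × ℝ | |ρ * p.1 + τ * p.2| ≤ b} := measurableSet_le hlin measurable_const
  have hA : MeasurableSet {p : ℝ × ℝ | |p.1| ≤ a ∧ |ρ * p.1 + τ * p.2| ≤ b} := by
    rw [Set.setOf_and]
    exact (measurableSet_le (by fun_prop) measurable_const).inter hB
  -- the three probabilities as integrals over `t`
  have h1 : γ.real (Icc (-a) a) = ∫ t, f t ∂γ := by
    rw [hf, integral_indicator_one measurableSet_Icc]
  have h2 : (γ.prod γ).real {p : ℝ × ℝ | |ρ * p.1 + τ * p.2| ≤ b} = ∫ t, g t ∂γ := by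
    rw [measureReal_prod_eq_integral_left γ γ hB]
    rfl
  have h3 : (γ.prod γ).real {p : ℝ × ℝ | |p.1| ≤ a ∧ |ρ * p.1 + τ * p.2| ≤ b}
      = ∫ t, f t * g t ∂γ := by
    rw [measureReal_prod_eq_integral_left γ γ hA]
    refine integral_congr_ae (Eventually.of_forall fun t => ?_)
    show γ.real (Prod.mk t ⁻¹' {p : ℝ × ℝ | |p.1| ≤ a ∧ |ρ * p.1 + τ * p.2| ≤ b}) = f t * g t
    by_cases ht : |t| ≤ a
    · have hmem : t ∈ Icc (-a) a := by rw [Set.mem_Icc]; exact abs_le.1 ht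
      rw [hf, Set.indicator_of_mem hmem, Pi.one_apply, one_mul, hg]
      congr 1
      ext w
      simp [ht]
    · have hnmem : t ∉ Icc (-a) a := by rw [Set.mem_Icc, ← abs_le]; exact ht
      rw [hf, Set.indicator_of_notMem hnmem, zero_mul]
      have : Prod.mk t ⁻¹' {p : ℝ × ℝ | |p.1| ≤ a ∧ |ρ * p.1 + τ * p.2| ≤ b} = ∅ := by
        ext w
        simp [ht]
      rw [this, measureReal_empty]
  rw [h1, h2, h3]
  -- Chebyshev with the two comonotone functions of `|t|`
  have hfm : Measurable f := (measurable_const.indicator measurableSet_Icc)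
  have hgm : Measurable g := by
    have hc : Continuous fun t : ℝ => (gaussianReal (ρ * t / τ) 1).real (Icc (-(b / τ)) (b / τ)) :=
      (continuous_gaussianReal_real_Icc_symm (div_nonneg hb hτ.le)).comp (by fun_prop)
    have e : g = fun t : ℝ => (gaussianReal (ρ * t / τ) 1).real (Icc (-(b / τ)) (b / τ)) := by
      funext t
      exact gaussianReal_real_absLinear_le hτ b t
    rw [e]
    exact hc.measurable
  have hfb : ∀ t, |f t| ≤ 1 := fun t => by
    simp only [hf, Set.indicator_apply]
    split_ifs <;> simp
  have hgb : ∀ t, |g t| ≤ 1 := fun t => by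
    rw [hg, abs_of_nonneg measureReal_nonneg]
    exact measureReal_le_one
  have hf_anti : ∀ x y : ℝ, |x| ≤ |y| → f y ≤ f x := by
    intro x y hxy
    simp only [hf, Set.indicator_apply, Set.mem_Icc]
    by_cases hy : -a ≤ y ∧ y ≤ a
    · have hx : -a ≤ x ∧ x ≤ a := abs_le.1 (hxy.trans (abs_le.2 hy))
      rw [if_pos hy, if_pos hx, Pi.one_apply, Pi.one_apply]
    · rw [if_neg hy]
      split_ifs <;> norm_num
  have hg_anti : ∀ x y : ℝ, |x| ≤ |y| → g y ≤ g x := fun x y hxy =>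
    gaussianReal_real_absLinear_le_anti hτ hb hxy
  refine integral_mul_ge_of_comonotone hfm hgm hfb hgb fun x y => ?_
  rcases le_total |x| |y| with hxy | hxy
  · have e1 := hf_anti x y hxy
    have e2 := hg_anti x y hxy
    exact mul_nonneg (by linarith) (by linarith)
  · have e1 := hf_anti y x hxy
    have e2 := hg_anti y x hxy
    exact mul_nonneg_of_nonpos_of_nonpos (by linarith) (by linarith)

/-- **The second marginal**: if `ρ² + τ² = 1` then `Y = ρZ₁ + τZ₂` is standard normal, so
`P(|Y| ≤ b) = N(0,1)([−b, b])`. [ours] -/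
theorem gaussianPair_absLinear_le_eq {ρ τ : ℝ} (hρτ : ρ ^ 2 + τ ^ 2 = 1) (b : ℝ) :
    ((gaussianReal 0 1).prod (gaussianReal 0 1)).real {p : ℝ × ℝ | |ρ * p.1 + τ * p.2| ≤ b}
      = (gaussianReal 0 1).real (Icc (-b) b) := by
  set γ := gaussianReal 0 1 with hγ
  have hX : (γ.prod γ).map (fun p : ℝ × ℝ => ρ * p.1) = gaussianReal (ρ * 0) (NNReal.mk (ρ ^ 2) (sq_nonneg _) * 1) := by
    rw [show (fun p : ℝ × ℝ => ρ * p.1) = (fun x : ℝ => ρ * x) ∘ Prod.fst from rfl,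
      ← Measure.map_map (measurable_const_mul ρ) measurable_fst, Measure.map_fst_prod, measure_univ,
      one_smul, hγ, gaussianReal_map_const_mul]
  have hY : (γ.prod γ).map (fun p : ℝ × ℝ => τ * p.2) = gaussianReal (τ * 0) (NNReal.mk (τ ^ 2) (sq_nonneg _) * 1) := by
    rw [show (fun p : ℝ × ℝ => τ * p.2) = (fun x : ℝ => τ * x) ∘ Prod.snd from rfl,
      ← Measure.map_map (measurable_const_mul τ) measurable_snd, Measure.map_snd_prod, measure_univ,
      one_smul, hγ, gaussianReal_map_const_mul]
  have hind : IndepFun (fun p : ℝ × ℝ => ρ * p.1) (fun p : ℝ × ℝ => τ * p.2) (γ.prod γ) :=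
    indepFun_prod (measurable_const_mul ρ) (measurable_const_mul τ)
  have hsum := gaussianReal_add_gaussianReal_of_indepFun hind hX hY
  have hvar : NNReal.mk (ρ ^ 2) (sq_nonneg _) * 1 + NNReal.mk (τ ^ 2) (sq_nonneg _) * 1 = 1 := by
    apply NNReal.eq
    rw [NNReal.coe_add, NNReal.coe_mul, NNReal.coe_mul, NNReal.coe_one, mul_one, mul_one]
    show ρ ^ 2 + τ ^ 2 = 1
    exact hρτ
  rw [mul_zero, mul_zero, add_zero, hvar] at hsum
  have hmeas : Measurable ((fun p : ℝ × ℝ => ρ * p.1) + fun p : ℝ × ℝ => τ * p.2) := by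
    exact (measurable_const_mul ρ |>.comp measurable_fst).add (measurable_const_mul τ |>.comp measurable_snd)
  have hset : {p : ℝ × ℝ | |ρ * p.1 + τ * p.2| ≤ b}
      = ((fun p : ℝ × ℝ => ρ * p.1) + fun p : ℝ × ℝ => τ * p.2) ⁻¹' Icc (-b) b := by
    ext p
    simp only [Set.mem_setOf_eq, Set.mem_preimage, Pi.add_apply, Set.mem_Icc, abs_le]
  rw [hset, measureReal_def, measureReal_def, ← Measure.map_apply hmeas measurableSet_Icc, hsum]

/-- **ŠIDÁK FOR TWO CRITERIA, CALIBRATED FORM**: with `ρ² + τ² = 1` (so both `X` and `Y` are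
standard normal with correlation `ρ`, `τ > 0` i.e. `|ρ| < 1`), every `a` and `b ≥ 0`:
`N(0,1)([−a,a]) · N(0,1)([−b,b]) ≤ P(|X| ≤ a ∧ |Y| ≤ b)` — two symmetric-window criteria at
single levels `c(a)`, `c(b)` pass JOINTLY with probability at least `c(a)·c(b)`, whatever `ρ`. [ours] -/
theorem gaussianPair_sidak_two {ρ τ : ℝ} (hτ : 0 < τ) (hρτ : ρ ^ 2 + τ ^ 2 = 1) (a : ℝ) {b : ℝ}
    (hb : 0 ≤ b) :
    (gaussianReal 0 1).real (Icc (-a) a) * (gaussianReal 0 1).real (Icc (-b) b)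
      ≤ ((gaussianReal 0 1).prod (gaussianReal 0 1)).real
        {p : ℝ × ℝ | |p.1| ≤ a ∧ |ρ * p.1 + τ * p.2| ≤ b} := by
  rw [← gaussianPair_absLinear_le_eq hρτ b]
  exact gaussianPair_abs_le_inter_ge_mul ρ hτ a hb

/-- **The Šidák window is conservative for two dependent criteria**: if the per-criterion window
`z ≥ 0` is calibrated for two INDEPENDENT criteria at table level `L` (`N(0,1)([−z,z])² = L`, the
`k = 2` Šidák `z` of `Scoring/SimultaneousAgreementTwoSigma.existsUnique_sidak_z`), then two
criteria from the same pair of runs (standard bivariate normal limit, any `|ρ| < 1`) pass jointly with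
probability `≥ L`. [ours] -/
theorem gaussianPair_sidak_z_conservative {ρ τ : ℝ} (hτ : 0 < τ) (hρτ : ρ ^ 2 + τ ^ 2 = 1) {z L : ℝ}
    (hz : 0 ≤ z) (hL : (gaussianReal 0 1).real (Icc (-z) z) ^ 2 = L) :
    L ≤ ((gaussianReal 0 1).prod (gaussianReal 0 1)).real
        {p : ℝ × ℝ | |p.1| ≤ z ∧ |ρ * p.1 + τ * p.2| ≤ z} := by
  rw [← hL, sq]
  exact gaussianPair_sidak_two hτ hρτ z hz

end GaussianPair

/-! ## §3 Several criteria loading on one common factor: products of comonotone `[0,1]`-functions -/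

section OneFactor

variable {α : Type*} [MeasurableSpace α] {μ : Measure α} [IsProbabilityMeasure μ]

/-- **ONE-FACTOR ŠIDÁK, ANALYTIC CORE.**  Let `g_j : α → [0,1]` (`j < J`) be measurable and all
non-increasing in a common score `r : α → ℝ` (`r x ≤ r y ⇒ g_j y ≤ g_j x`).  Then under any
probability law `∏_j ∫ g_j ≤ ∫ ∏_j g_j`.  Reading: `J` criteria which, conditionally on a common
Gaussian factor `t`, are independent with pass probabilities `g_j(t)` each decreasing in `|t|`
(e.g. symmetric windows for `ρ_j t + τ_j Z_j`, §2) pass JOINTLY with probability at least the product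
of their single levels. [ours] -/
theorem prod_integral_le_integral_prod_of_antitone_score {J : ℕ} (g : Fin J → α → ℝ) (r : α → ℝ)
    (hm : ∀ j, Measurable (g j)) (h0 : ∀ j x, 0 ≤ g j x) (h1 : ∀ j x, g j x ≤ 1)
    (hanti : ∀ j x y, r x ≤ r y → g j y ≤ g j x) :
    ∏ j, ∫ x, g j x ∂μ ≤ ∫ x, ∏ j, g j x ∂μ := by
  induction J with
  | zero => simp
  | succ J ih =>
    -- split off the last factor
    have hsplit : ∀ x, ∏ j : Fin (J + 1), g j x = (∏ j : Fin J, g (Fin.castSucc j) x) * g (Fin.last J) x :=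
      fun x => Fin.prod_univ_castSucc _
    simp_rw [hsplit, Fin.prod_univ_castSucc]
    -- the product of the first `J` factors is again a comonotone `[0,1]`-function
    set G : α → ℝ := fun x => ∏ j : Fin J, g (Fin.castSucc j) x with hG
    have hGm : Measurable G := Finset.measurable_prod _ fun j _ => hm _
    have hG0 : ∀ x, 0 ≤ G x := fun x => Finset.prod_nonneg fun j _ => h0 _ x
    have hG1 : ∀ x, G x ≤ 1 := fun x => Finset.prod_le_one (fun j _ => h0 _ x) fun j _ => h1 _ x
    have hGanti : ∀ x y, r x ≤ r y → G y ≤ G x := fun x y hxy =>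
      Finset.prod_le_prod (fun j _ => h0 _ y) fun j _ => hanti _ x y hxy
    -- induction hypothesis for the first `J` factors
    have hih := ih (fun j => g (Fin.castSucc j)) (fun j => hm _) (fun j => h0 _) (fun j => h1 _)
      (fun j => hanti _)
    -- Chebyshev for `G` and the last factor
    have hcheb := integral_mul_ge_of_comonotone (μ := μ) hGm (hm (Fin.last J)) (Cf := 1) (Cg := 1)
      (fun x => by rw [abs_of_nonneg (hG0 x)]; exact hG1 x)
      (fun x => by rw [abs_of_nonneg (h0 _ x)]; exact h1 _ x)
      (fun x y => by
        rcases le_total (r x) (r y) with hxy | hxy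
        · exact mul_nonneg (by linarith [hGanti x y hxy]) (by linarith [hanti (Fin.last J) x y hxy])
        · exact mul_nonneg_of_nonpos_of_nonpos (by linarith [hGanti y x hxy])
            (by linarith [hanti (Fin.last J) y x hxy]))
    have hlast0 : 0 ≤ ∫ x, g (Fin.last J) x ∂μ := integral_nonneg fun x => h0 _ x
    calc (∏ j : Fin J, ∫ x, g (Fin.castSucc j) x ∂μ) * ∫ x, g (Fin.last J) x ∂μ
        ≤ (∫ x, G x ∂μ) * ∫ x, g (Fin.last J) x ∂μ := mul_le_mul_of_nonneg_right hih hlast0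
      _ ≤ ∫ x, G x * g (Fin.last J) x ∂μ := hcheb

end OneFactor

end Summit.Ventures.LatticeQCDFlow.Scoring
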